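import Summits.AtomisticToContinuum.BoseEinsteinCondensation.Theses.BECInfDivCoherence
import Summits.AtomisticToContinuum.BoseEinsteinCondensation.Theorems.BECInfDivCoherenceLevyMassCondensationGrid
import Summits.AtomisticToContinuum.BoseEinsteinCondensation.Theorems.BECInfDivCoherenceLevyMassCondensationTranslation
import Summits.AtomisticToContinuum.BoseEinsteinCondensation.Theorems.BECInfDivCoherenceLevyMassCondensationEnergy

/-!
# Route BECInfDivCoherence — `LevyMassCondensation` (glue item stmt-AtomisticToContinuum-9117)

The glue of the route: `GridInfDivCoherence → LevyNegativeMoment → ScatteringLengthFinite →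
GridAverageCondensate → PeriodicBEC` (constant-mode condensation of near-minimisers of the
periodic energy on the torus of side `L = (N/ρ)^{1/3}` at every small density).

Proof (finite-dimensional but for the two analytic inputs, as planned by the route). Fix `v` of
range `≤ R`; take `η, ρ₁` from `GridInfDivCoherence`, `C, ρ₂` from `LevyNegativeMoment` at that
`η`, and `ρ₃` from the uniform energy ceiling `E₀^per ≤ 16πRρN =: eN`
(`periodicGroundStateEnergy_le_uniform`, Dyson–LSSY through the hard core of radius `2R`; this is
why `ScatteringLengthFinite` is not needed). Put `Λ = π² + C`, `c = e^{-Λ}/2`,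
`κ = min(1/2, 1/(8η²), c/(2η²))` and `ρ₀ = min(ρ₁, ρ₂, ρ₃, κ/(16πR))`. For `ρ < ρ₀` and `N` large
(`N ≥ 2`, `1/N ≤ κ`, `L ≥ 3η`, inside the eventual ranges of the three inputs): `m = ⌊L/η⌋ ≥ 3`,
`h = L/m ≤ 2η`, `ε = h²/(6m³)`, `δ = min(δ₁(ε), δ₂, 1)`. For a `δ`-near-minimiser `Ψ`:
kinetic energy `≤ eN + 1`, so some particle `i` has `τ_i = Σ_k ∫|∂_{ik}Ψ|² ≤ e + 1/N ≤ 2κ`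
(`exists_particle_kinetic_le`); its translation coherence `G` has `G(0) = 1`, `G ≤ 1`, period `L`
and `1 - G(±h e_a) ≤ (h²/2) τ_{i,a} ≤ 1/2` (`one_sub_coh_le`), hence `-log G(±h e_a) ≤ h² τ_{i,a}`.
With `F = log G` on the grid and `ν` its discrete Lévy weights: the f-sum identity
(`levyWeight_fsum`) gives `Σ_q ν_q λ_q ≤ h²(e + 1/N)`; with `ν ≥ -ε` off `0` (crux 1) and the
`(-1)`-moment bound `≤ C` (crux 2), `levyMass_le` gives `Σ_{q≠0} ν⁺_q ≤ (π²/2)(e + 1/N + 1) + C ≤ Λ`;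
the total weight is `Σ_q ν_q = F(0) = 0` (`sum_levyWeight`), so the grid mean of `F` is
`ν_0 = -Σ_{q≠0} ν_q ≥ -Λ`, and by AM–GM the grid mean of `G` is `≥ e^{-Λ} = 2c`. Finally
`GridAverageCondensate` with `T = eN + 1` gives `n₀ ≥ N·2c - T h²/(4π²) ≥ 2cN - (e + 1/N)η²N ≥ cN`.
-/

noncomputable section

namespace Summit.AtomisticToContinuum.BoseEinsteinCondensation.Theorems

open MeasureTheory Filter Literature.MathematicalPhysics.QuantumManyBody.BoseGas
open scoped ENNReal ComplexConjugate

open InfDivGlue in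
/-- Settles `stmt-AtomisticToContinuum-9117` (exact signature of the route decl
`LevyMassCondensation`): the glue `GridInfDivCoherence → LevyNegativeMoment →
ScatteringLengthFinite → GridAverageCondensate → PeriodicBEC` of route `BECInfDivCoherence`
(discrete Lévy–Khintchine bookkeeping on the `η`-grid, kinetic short-distance bound, AM–GM, and the
Dyson–LSSY energy ceiling; see the module docstring). [folklore] -/
theorem levyMassCondensation_proof :
    Summit.AtomisticToContinuum.BoseEinsteinCondensation.Theses.BECInfDivCoherence.LevyMassCondensation := by
  -- the elementary inequality `-log x ≤ 2 (1 - x)` on `[1/2, 1]`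
  have neg_log_le_two_mul_one_sub : ∀ {x : ℝ}, 1 / 2 ≤ x → x ≤ 1 →
      -Real.log x ≤ 2 * (1 - x) := by
    intro x hx hx1
    have hx0 : 0 < x := by linarith
    have h1 := Real.one_sub_inv_le_log_of_pos hx0
    have h2 : x⁻¹ - 1 ≤ 2 * (1 - x) := by
      rw [inv_eq_one_div, div_sub_one hx0.ne', div_le_iff₀ hx0]
      nlinarith
    linarith
  unfold Theses.BECInfDivCoherence.LevyMassCondensation
  intro h1 h2 _ h4 v hv
  obtain ⟨R₀, hR₀⟩ := hv.2
  -- a positive range bound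
  set R : ℝ := max R₀ 1 with hRdef
  have hR : 0 < R := lt_max_of_lt_right one_pos
  have hvR : ∀ r, R < r → v r = 0 := fun r hr => hR₀ r ((le_max_left _ _).trans_lt hr)
  obtain ⟨η, hη, ρ₁, hρ₁, H1⟩ := h1 v hv
  obtain ⟨C, ρ₂, hρ₂, H2⟩ := h2 v hv η hη
  obtain ⟨ρ₃, hρ₃, H3⟩ := periodicGroundStateEnergy_le_uniform hR
  -- constants
  set Λ : ℝ := Real.pi ^ 2 + C with hΛ
  set c : ℝ := Real.exp (-Λ) / 2 with hc
  have hcpos : 0 < c := by positivity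
  set κ : ℝ := min (1 / 2) (min (1 / (8 * η ^ 2)) (c / (2 * η ^ 2))) with hκ
  have hκpos : 0 < κ := by positivity
  have hκ1 : κ ≤ 1 / 2 := min_le_left _ _
  have hκ2 : κ ≤ 1 / (8 * η ^ 2) := (min_le_right _ _).trans (min_le_left _ _)
  have hκ3 : κ ≤ c / (2 * η ^ 2) := (min_le_right _ _).trans (min_le_right _ _)
  set ρ₄ : ℝ := κ / (16 * Real.pi * R) with hρ₄
  have hρ₄pos : 0 < ρ₄ := by positivity
  refine ⟨min (min ρ₁ ρ₂) (min ρ₃ ρ₄), by positivity, fun ρ hρ hρlt => ?_⟩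
  have hρ1 : ρ < ρ₁ := hρlt.trans_le ((min_le_left _ _).trans (min_le_left _ _))
  have hρ2 : ρ < ρ₂ := hρlt.trans_le ((min_le_left _ _).trans (min_le_right _ _))
  have hρ3 : ρ < ρ₃ := hρlt.trans_le ((min_le_right _ _).trans (min_le_left _ _))
  have hρ4 : ρ < ρ₄ := hρlt.trans_le ((min_le_right _ _).trans (min_le_right _ _))
  -- the energy per particle `e = 16πRρ < κ`
  set e : ℝ := 16 * Real.pi * R * ρ with he
  have hepos : 0 ≤ e := by positivity
  have heκ : e < κ := by
    rw [he, hρ₄] at *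
    have : 16 * Real.pi * R * ρ < 16 * Real.pi * R * (κ / (16 * Real.pi * R)) :=
      mul_lt_mul_of_pos_left hρ4 (by positivity)
    rwa [mul_div_cancel₀ _ (by positivity : (16 * Real.pi * R : ℝ) ≠ 0)] at this
  refine ⟨c, hcpos, ?_⟩
  have hNκ : ∀ᶠ N : ℕ in atTop, (1 : ℝ) / N ≤ κ :=
    tendsto_one_div_atTop_nhds_zero_nat.eventually (eventually_le_nhds hκpos)
  filter_upwards [H1 ρ hρ hρ1, H2 ρ hρ hρ2, H3 ρ hρ hρ3, eventually_ge_atTop 2, hNκ,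
    (tendsto_sideLength_atTop hρ).eventually_ge_atTop (3 * η)] with N hN1 hN2 hN3 hN2le hNκ' hL3η
  have hN0 : 0 < N := by omega
  have hNpos : (0 : ℝ) < N := by exact_mod_cast hN0
  have hE0 : periodicGroundStateEnergy v N (sideLength ρ N) ≤ ENNReal.ofReal (e * N) := by
    have := hN3 v hvR; rwa [he]
  have hLpos : 0 < sideLength ρ N := by
    unfold sideLength; exact Real.rpow_pos_of_pos (div_pos hNpos hρ) _
  have heN : e + 1 / N ≤ 2 * κ := by linarith
  clear hN3 H1 H2 H3
  generalize sideLength ρ N = L at hN1 hN2 hE0 hLpos hL3η ⊢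
  -- the grid size `m = ⌊L/η⌋ ≥ 3` and spacing `h = L/m ≤ 2η`
  have hm3 : 3 ≤ ⌊L / η⌋₊ := Nat.le_floor (by rw [Nat.cast_ofNat, le_div_iff₀ hη]; linarith)
  have hmlt : L / η < ⌊L / η⌋₊ + 1 := Nat.lt_floor_add_one _
  dsimp only at hN1 hN2
  generalize hmdef : ⌊L / η⌋₊ = m at hN1 hN2 hm3 hmlt
  haveI : NeZero m := ⟨by omega⟩
  have hm2 : 2 ≤ m := by omega
  have hm0 : 0 < m := by omega
  have hmpos : (0 : ℝ) < m := by exact_mod_cast hm0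
  have hm3r : (3 : ℝ) ≤ m := by exact_mod_cast hm3
  set h : ℝ := L / m with hh
  have hhpos : 0 < h := div_pos hLpos hmpos
  have hhm : h * m = L := div_mul_cancel₀ _ hmpos.ne'
  have hh2 : h ≤ 2 * η := by
    rw [hh, div_le_iff₀ hmpos]
    rw [div_lt_iff₀ hη] at hmlt
    nlinarith
  have hh2sq : h ^ 2 ≤ 4 * η ^ 2 := by nlinarith
  set ε : ℝ := h ^ 2 / (6 * (m : ℝ) ^ 3) with hεdef
  have hεpos : 0 < ε := by positivity
  obtain ⟨δ₁, hδ₁, H1'⟩ := hN1 ε hεpos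
  obtain ⟨δ₂, hδ₂, H2'⟩ := hN2
  refine ⟨min (min δ₁ δ₂) 1, lt_min (lt_min hδ₁ hδ₂) one_pos, fun Ψ hΨ => ?_⟩
  have hΨ1 : periodicEnergy v Ψ ≤ periodicGroundStateEnergy v N L + δ₁ :=
    hΨ.trans (add_le_add le_rfl ((min_le_left _ _).trans (min_le_left _ _)))
  have hΨ2 : periodicEnergy v Ψ ≤ periodicGroundStateEnergy v N L + δ₂ :=
    hΨ.trans (add_le_add le_rfl ((min_le_left _ _).trans (min_le_right _ _)))
  -- kinetic energy `≤ eN + 1`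
  set T : ℝ := e * N + 1 with hT
  have hTpos : 0 ≤ T := by positivity
  have hkin : (∫⁻ X in cellN N L, kineticDensity Ψ.ψ X) ≤ ENNReal.ofReal T :=
    calc (∫⁻ X in cellN N L, kineticDensity Ψ.ψ X) ≤ periodicEnergy v Ψ :=
          lintegral_kineticDensity_le_periodicEnergy v Ψ
      _ ≤ periodicGroundStateEnergy v N L + min (min δ₁ δ₂) 1 := hΨ
      _ ≤ ENNReal.ofReal (e * N) + 1 := add_le_add hE0 (min_le_right _ _)
      _ = ENNReal.ofReal T := by
          rw [hT, ENNReal.ofReal_add (by positivity) zero_le_one, ENNReal.ofReal_one]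
  -- a particle with kinetic energy `≤ T/N = e + 1/N`
  obtain ⟨i, hi⟩ := exists_particle_kinetic_le Ψ hN0 hkin
  have hTN : ENNReal.ofReal T / N = ENNReal.ofReal (e + 1 / N) := by
    rw [hT, show e + 1 / N = (e * N + 1) / N by field_simp, ENNReal.ofReal_div_of_pos hNpos,
      ENNReal.ofReal_natCast]
  rw [hTN] at hi
  set τ : Fin 3 → ℝ≥0∞ := fun k => ∫⁻ X in cellN N L,
    (‖fderiv ℝ Ψ.ψ X (Pi.single i (EuclideanSpace.single k (1 : ℝ)))‖₊ : ℝ≥0∞) ^ 2 with hτdef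
  have hτfin : ∀ k, τ k ≠ ⊤ := fun k =>
    ne_top_of_le_ne_top ENNReal.ofReal_ne_top
      ((Finset.single_le_sum (f := τ) (fun _ _ => zero_le) (Finset.mem_univ k)).trans hi)
  have hτsum : ∑ k, (τ k).toReal ≤ e + 1 / N := by
    rw [← ENNReal.toReal_sum fun k _ => hτfin k]
    exact ENNReal.toReal_le_of_le_ofReal (by positivity) hi
  have hτle : ∀ k, (τ k).toReal ≤ e + 1 / N := fun k =>
    (Finset.single_le_sum (f := fun k => (τ k).toReal) (fun _ _ => ENNReal.toReal_nonneg)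
      (Finset.mem_univ k)).trans hτsum
  -- the translation coherence of particle `i`
  set G : Space → ℝ := fun r =>
    (∫ X in cellN N L, conj (Ψ.ψ (Function.update X i (X i + r))) * Ψ.ψ X).re with hGdef
  have hG0 : G 0 = 1 := coh_zero Ψ i
  have hGle : ∀ r, G r ≤ 1 := fun r => coh_le_one hLpos Ψ i r
  have hGper : ∀ (r : Space) (k : Fin 3), G (r + EuclideanSpace.single k L) = G r :=
    fun r k => coh_add_single Ψ i r k
  have hGtrans : ∀ (k : Fin 3) (s : ℝ),
      1 - G (s • EuclideanSpace.single k 1) ≤ s ^ 2 / 2 * (τ k).toReal :=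
    fun k s => one_sub_coh_le hLpos Ψ i k s (hτfin k)
  -- the two crux inputs for this particle
  set F : (Fin 3 → Fin m) → ℝ := fun j =>
    Real.log (G (latticeVec h fun k => ((j k : ℕ) : ℤ))) with hFdef
  set ν : (Fin 3 → Fin m) → ℝ := fun q =>
    (∑ j : Fin 3 → Fin m, F j *
      Real.cos (2 * Real.pi * (∑ k, ((q k : ℕ) : ℝ) * ((j k : ℕ) : ℝ)) / m)) / (m : ℝ) ^ 3 with hνdef
  have H1i : (∀ r, 0 < G r) ∧ ∀ q : Fin 3 → Fin m, (∃ k, (q k : ℕ) ≠ 0) → -ε ≤ ν q := H1' Ψ hΨ1 i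
  have H2i : (∑ q : Fin 3 → Fin m with (∃ k, (q k : ℕ) ≠ 0), max (ν q) 0 /
      (2 * Real.pi / L * Real.sqrt (∑ k, ((min (q k : ℕ) (m - (q k : ℕ)) : ℕ) : ℝ) ^ 2))) ≤ C :=
    H2' Ψ hΨ2 i
  obtain ⟨hGpos, hνε⟩ := H1i
  have h4i : ENNReal.ofReal (N * (∑ j : Fin 3 → Fin m, G (latticeVec h fun k => ((j k : ℕ) : ℤ))) /
      (m : ℝ) ^ 3 - T * h ^ 2 / (4 * Real.pi ^ 2)) ≤ condensateOccupation N L Ψ.ψ :=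
    h4 N m L T hLpos hm0 hTpos Ψ hkin i
  clear_value G τ
  -- the grid nodes `± h e_a` and the values `F 0 = 0`, `F (±e_a) = log G(±h e_a)`
  have hF0 : F 0 = 0 := by
    have h0 : (latticeVec h fun k => (((0 : Fin 3 → Fin m) k : ℕ) : ℤ)) = 0 := by
      rw [← latticeVec_zero h]; congr 1
    show Real.log (G (latticeVec h fun k => (((0 : Fin 3 → Fin m) k : ℕ) : ℤ))) = 0
    rw [h0, hG0, Real.log_one]
  have hF1 : ∀ a : Fin 3, F (Pi.single a 1) = Real.log (G (h • EuclideanSpace.single a 1)) := by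
    intro a
    show Real.log (G (latticeVec h fun k => (((Pi.single a (1 : Fin m) : Fin 3 → Fin m) k : ℕ) : ℤ))) = _
    rw [latticeVec_single_one hm2 h a]
  have hF2 : ∀ a : Fin 3, F (Pi.single a (-1)) = Real.log (G ((-h) • EuclideanSpace.single a 1)) := by
    intro a
    show Real.log (G (latticeVec h fun k => (((Pi.single a (-1 : Fin m) : Fin 3 → Fin m) k : ℕ) : ℤ))) = _
    rw [latticeVec_single_neg_one hm2 h a, hhm, hGper]
  -- `-log G(±h e_a) ≤ h² τ_a` (translation bound + `-log x ≤ 2(1-x)` on `[1/2,1]`)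
  have heN0 : 0 ≤ e + 1 / N := by positivity
  have hsmall : h ^ 2 / 2 * (e + 1 / N) ≤ 1 / 2 := by
    have h8 : 8 * η ^ 2 * κ ≤ 1 := by
      rw [le_div_iff₀ (by positivity)] at hκ2; linarith only [hκ2]
    calc h ^ 2 / 2 * (e + 1 / N) ≤ (4 * η ^ 2) / 2 * (2 * κ) := by gcongr
      _ = (8 * η ^ 2 * κ) / 2 := by ring
      _ ≤ 1 / 2 := by linarith only [h8]
  have hlog : ∀ (a : Fin 3) (s : ℝ), s ^ 2 = h ^ 2 →
      -Real.log (G (s • EuclideanSpace.single a 1)) ≤ h ^ 2 * (τ a).toReal := by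
    intro a s hs
    have h1' := hGtrans a s
    rw [hs] at h1'
    have hτa := hτle a
    have hτ0 : 0 ≤ (τ a).toReal := ENNReal.toReal_nonneg
    have hGhalf : 1 / 2 ≤ G (s • EuclideanSpace.single a 1) := by
      have : h ^ 2 / 2 * (τ a).toReal ≤ h ^ 2 / 2 * (e + 1 / N) :=
        mul_le_mul_of_nonneg_left hτa (by positivity)
      linarith only [h1', this, hsmall]
    have h2' := neg_log_le_two_mul_one_sub hGhalf (hGle _)
    linarith only [h1', h2']
  -- the discrete f-sum: `Σ_q ν_q λ_q ≤ h² (e + 1/N)`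
  have hA : ∑ q : Fin 3 → Fin m, ν q * (∑ a, (1 - Real.cos (2 * Real.pi * ((q a : ℕ) : ℝ) / m))) ≤
      h ^ 2 * (e + 1 / N) := by
    change ∑ q : Fin 3 → Fin m, (∑ j : Fin 3 → Fin m, F j *
      Real.cos (2 * Real.pi * (∑ k, ((q k : ℕ) : ℝ) * ((j k : ℕ) : ℝ)) / m)) / (m : ℝ) ^ 3 *
      (∑ a, (1 - Real.cos (2 * Real.pi * ((q a : ℕ) : ℝ) / m))) ≤ _
    rw [levyWeight_fsum hm2 F, hF0, mul_zero, zero_sub, neg_le]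
    have hterm : ∀ a : Fin 3, -((F (Pi.single a 1) + F (Pi.single a (-1))) / 2) ≤
        h ^ 2 * (τ a).toReal := by
      intro a
      rw [hF1, hF2]
      have h1' := hlog a h rfl
      have h2' := hlog a (-h) (by ring)
      linarith only [h1', h2']
    calc -(h ^ 2 * (e + 1 / N)) ≤ -(h ^ 2 * ∑ a, (τ a).toReal) := by
          have := mul_le_mul_of_nonneg_left hτsum (sq_nonneg h); linarith only [this]
      _ = ∑ a : Fin 3, -(h ^ 2 * (τ a).toReal) := by rw [Finset.mul_sum, Finset.sum_neg_distrib]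
      _ ≤ ∑ a : Fin 3, (F (Pi.single a 1) + F (Pi.single a (-1))) / 2 :=
          Finset.sum_le_sum fun a _ => by linarith only [hterm a]
  -- the Lévy mass bound `Σ_{q≠0} ν⁺_q ≤ Λ`
  have hmass : (∑ q : Fin 3 → Fin m with (∃ k, (q k : ℕ) ≠ 0), max (ν q) 0) ≤ Λ := by
    have hb := levyMass_le hm2 hLpos ν hεpos.le hνε hA H2i
    refine hb.trans ?_
    have h6 : 6 * ε * (m : ℝ) ^ 3 = h ^ 2 := by rw [hεdef]; field_simp
    rw [h6, ← hh]
    have hre : Real.pi ^ 2 / (2 * h ^ 2) * (h ^ 2 * (e + 1 / N) + h ^ 2) =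
        Real.pi ^ 2 / 2 * (e + 1 / N + 1) := by
      field_simp
    rw [hre, hΛ]
    have hπ2 : Real.pi ^ 2 / 2 * (e + 1 / N + 1) ≤ Real.pi ^ 2 / 2 * 2 :=
      mul_le_mul_of_nonneg_left (by linarith only [heN, hκ1]) (by positivity)
    linarith only [hπ2]
  -- `ν 0 ≥ -Λ` (total Lévy weight is `F 0 = 0`)
  have hsumν : ∑ q : Fin 3 → Fin m, ν q = F 0 := sum_levyWeight F
  have hν0 : -Λ ≤ ν 0 := by
    have hsplit := sum_eq_zero_add_sum_filter ν
    rw [hsumν, hF0] at hsplit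
    have hle : (∑ q : Fin 3 → Fin m with (∃ k, (q k : ℕ) ≠ 0), ν q) ≤
        ∑ q : Fin 3 → Fin m with (∃ k, (q k : ℕ) ≠ 0), max (ν q) 0 :=
      Finset.sum_le_sum fun q _ => le_max_left _ _
    linarith only [hsplit, hle, hmass]
  -- the mean of `F` over the grid is `ν 0`
  have hmean : (∑ j : Fin 3 → Fin m, F j) / (m : ℝ) ^ 3 = ν 0 := by
    simp only [hνdef]
    congr 1
    refine Finset.sum_congr rfl fun j _ => ?_
    simp
  -- Jensen: grid average of `G` is at least `exp(ν 0) ≥ exp(-Λ) = 2c`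
  have havg : 2 * c ≤ (∑ j : Fin 3 → Fin m, G (latticeVec h fun k => ((j k : ℕ) : ℤ))) / (m : ℝ) ^ 3 := by
    have hJ := exp_mean_log_le_mean (fun j : Fin 3 → Fin m => G (latticeVec h fun k => ((j k : ℕ) : ℤ)))
      (fun j => hGpos _)
    have hcard : (Fintype.card (Fin 3 → Fin m) : ℝ) = (m : ℝ) ^ 3 := by
      rw [Fintype.card_fun, Fintype.card_fin, Fintype.card_fin, Nat.cast_pow]
    rw [hcard] at hJ
    have hmean' : (∑ j : Fin 3 → Fin m, Real.log (G (latticeVec h fun k => ((j k : ℕ) : ℤ)))) /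
        (m : ℝ) ^ 3 = ν 0 := hmean
    rw [hmean'] at hJ
    calc 2 * c = Real.exp (-Λ) := by rw [hc]; ring
      _ ≤ Real.exp (ν 0) := Real.exp_le_exp.2 hν0
      _ ≤ _ := hJ
  -- `GridAverageCondensate` and the error term `T h²/(4π²) ≤ c N`
  refine le_trans (ENNReal.ofReal_le_ofReal ?_) h4i
  have hπ : 1 ≤ Real.pi ^ 2 := one_le_pow₀ (by linarith only [Real.pi_gt_three])
  have hκc : 2 * κ * η ^ 2 ≤ c := by
    rw [le_div_iff₀ (by positivity)] at hκ3; linarith only [hκ3]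
  have hTerr : T * h ^ 2 / (4 * Real.pi ^ 2) ≤ c * N := by
    have hTh : 0 ≤ T * h ^ 2 := by positivity
    calc T * h ^ 2 / (4 * Real.pi ^ 2) ≤ T * h ^ 2 / 4 :=
          div_le_div_of_nonneg_left hTh (by norm_num) (by linarith only [hπ])
      _ ≤ T * η ^ 2 := by
          have := mul_le_mul_of_nonneg_left hh2sq hTpos; linarith only [this]
      _ = N * ((e + 1 / N) * η ^ 2) := by rw [hT]; field_simp
      _ ≤ N * (2 * κ * η ^ 2) := by gcongr
      _ ≤ N * c := by gcongr
      _ = c * N := mul_comm _ _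
  have hmain := mul_le_mul_of_nonneg_left havg hNpos.le
  rw [mul_div_assoc]
  linarith only [hmain, hTerr]

end Summit.AtomisticToContinuum.BoseEinsteinCondensation.Theorems

end
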